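import Mathlib
import HarnessLib
import Literature.MathematicalPhysics.QuantumLattice.DWaveSource
import Literature.MathematicalPhysics.QuantumLattice.HubbardGrandCanonicalDensity
import Summits.HubbardSuperconductivity.HubbardSuperconductivity.Theorems.WeakCouplingBCSWcbcsBcsConstructionRegularEquationOfState
import Summits.HubbardSuperconductivity.HubbardSuperconductivity.Theorems.WeakCouplingBCSWcbcsBcsConstructionAeDensityConvergence
import Summits.HubbardSuperconductivity.HubbardSuperconductivity.Theorems.WeakCouplingBCSWcbcsBcsConstructionGcDensitySandwichFree
import Summits.HubbardSuperconductivity.HubbardSuperconductivity.Theorems.ChiralWindowCwChiralConstructionKLWindowOfPoint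
import Summits.HubbardSuperconductivity.HubbardSuperconductivity.Theorems.ChiralWindowCwChiralConstructionOfKLMechanism
import Summits.HubbardSuperconductivity.HubbardSuperconductivity.Theorems.ChiralWindowCwChiralConstructionFillingAtNegThreeTenths
import Summits.HubbardSuperconductivity.HubbardSuperconductivity.Theorems.ChiralWindowCwChannelInfContinuousFilling

/-!
# Crux `WcbcsBcsConstruction` (stmt-HubbardSuperconductivity-2010) — the strategist's split glue

Route `HubbardSuperconductivity/WeakCouplingBCS`, rank-4 crux ("the research programme"). Crux-strategist seat
planner-cstrat-stmt-HubbardSuperconductivity-2010-s1-0 (gen 1), 2026-08-17.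

Kernel-checked implication for the typed split of the crux into the THREE propositions that, since lead c5
(rev c5-2) of line `ladder-scale-certified-chain`, are the only open registered stubs of this crux — two of them
byte-identical with the two open stubs of the sibling crux `ChiralWindow.CwChiralConstruction` (stmt-1740) and with
the children of the split PREPARED there (`Cruxes/CwChiralConstruction/SPLIT-PROPOSAL.md`), so that ONE item serves
both routes (dedup by normalised signature):

* (Kpt) **`B₁g` strictly leading at ONE window doping** `δ₀ ∈ [3/10, 12/25]` with margin `γU²` for all `U < U₁`
  (the whole Kohn–Luttinger INPUT; certified numerics; closed modulo the one-point enclosure `stub_klPointEnclosure`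
  by the landed p146657 ∘ p148296 ∘ p145573) — VERBATIM child 1 of the sibling's SPLIT-PROPOSAL;
* (M) **the Kohn–Luttinger mechanism in local uniform form** — on every level window `[μ₁, μ₂] ⊂ [-2, -3/10]` where
  `B₁g` leads by `γU²` for `U < U₁`, an order floor `e^{-C/U²} ≤ dWaveOrderParameter U μ` on all operator levels
  `μ ∈ [μ₁ + U/2, μ₂]`, `U < U₀` (the open constructive problem, record-free) — VERBATIM child 2 of the sibling's
  SPLIT-PROPOSAL and the registered stub `stub_dWaveOrderFloorOnLeadingWindows` of both skeletons;
* (D) **no density jump on level windows at weak coupling** — VERBATIM the registered stub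
  `stub_noDensityJumpOnLevelWindows` of `Lines/ladder_scale_certified_chain.lean` rev c5-2 (needed ONLY because the typed
  crux asks ONE `U`-uniform doping `δ`).

`wcbcsBcsConstruction_of_subs : (Kpt) → (M) → (D) → <body of WcbcsBcsConstruction>` is the composition of LANDED theorems
only: `stub_klLeadingMuWindowOfPoint` (p141740), `filling_neg_two_le_half'`, `stub_fillingAtNegThreeTenths` (p141417),
`monotone_filling` / `strictMonoOn_filling`, `wcbcs_eos_differentiableAt_of_noDensityJump`,
`wcbcs_tendsto_gcEnergyDensity_limUnder`, `wcbcs_tendsto_gcDensity_of_differentiableAt`, `stub_gcDensitySandwichFree`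
(p148887), `exists_tendsto_gcDensity_of_regularWindow` (Literature). It is the body of `WcbcsBcsConstruction_of` of the
registered skeleton rev c5-2 with the three stubs abstracted as hypotheses and the crux conclusion SPELLED OUT (no import
of `Theses.WeakCouplingBCS`, so the gate can link it into the route file without a cycle). None of the three hypotheses is
the crux reworded: (Kpt) speaks of the free band and the second-order kernel only; (M) is uniform on level windows under an
explicit KL-leading hypothesis and fixes no doping; (D) is an `h = 0` equation-of-state statement with no order in it.
-/

set_option linter.dupNamespace false

namespace Summit.HubbardSuperconductivity.HubbardSuperconductivity.Theorems

open Literature.MathematicalPhysics.QuantumLattice Filter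
open scoped Topology

/-- **Split glue of crux `WcbcsBcsConstruction` (strategist, gen 1).** (Kpt) `B₁g` strictly leading with margin `γU²` at
one window doping `δ₀ ∈ [3/10, 12/25]` for all small `U`, (M) the Kohn–Luttinger mechanism in local uniform form and (D) no
grand-canonical density jump on level windows `⊂ [-2, -3/10]` at weak coupling together imply the typed crux
`WcbcsBcsConstruction` (body spelled out). Window `[m, μ₂]`, `m = (μ₁+μ₂)/2`, of the KL level window delivered by (Kpt)
through p141740; step `r = (μ₂-m)/6`; brackets `1-b = F(m+2r) < F(μ₂-2r) = 1-a` inside `(13/25, 7/10)`; (D) makes the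
limiting equation of state differentiable on `[m, μ₂]`; the free/interacting density sandwich (p148887) at
`U ≤ r·min(F(m+2r)-F(m+r), F(μ₂-r)-F(μ₂-2r))` brackets the end densities; Darboux picks `μ(U) ∈ [m, μ₂]` with density
`→ 1-a`; (M) gives the floor there. `δ := a`. [cite: KohnLuttinger1965] [cite: RaghuKivelsonScalapino2010, §II (7), (13)]
[cite: KomaTasaki1994, §1] -/
theorem wcbcsBcsConstruction_of_subs :
    (∃ δ₀ ∈ Set.Icc (3/10 : ℝ) (12/25), ∃ γ U₁ : ℝ, 0 < γ ∧ 0 < U₁ ∧ ∀ U ∈ Set.Ioo (0:ℝ) U₁,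
      ∀ χ : D4Irrep, χ ≠ D4Irrep.B1g →
        channelInf (squareDispersion 1 0) (chemicalPotentialOfDensity (squareDispersion 1 0) (1 - δ₀)) U D4Irrep.B1g
            + γ * U ^ 2 ≤
          channelInf (squareDispersion 1 0) (chemicalPotentialOfDensity (squareDispersion 1 0) (1 - δ₀)) U χ) →
    (∀ μ₁ μ₂ γ U₁ : ℝ, -2 ≤ μ₁ → μ₁ < μ₂ → μ₂ ≤ -(3:ℝ) / 10 → 0 < γ → 0 < U₁ →
      (∀ U ∈ Set.Ioo (0:ℝ) U₁, ∀ μ ∈ Set.Icc μ₁ μ₂, ∀ χ : D4Irrep, χ ≠ D4Irrep.B1g →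
        channelInf (squareDispersion 1 0) μ U D4Irrep.B1g + γ * U ^ 2 ≤ channelInf (squareDispersion 1 0) μ U χ) →
      ∃ U₀ C : ℝ, 0 < U₀ ∧ 0 < C ∧ ∀ U ∈ Set.Ioo (0:ℝ) U₀, ∀ μ ∈ Set.Icc (μ₁ + U / 2) μ₂,
        Real.exp (-C / U ^ 2) ≤ dWaveOrderParameter U μ) →
    (∀ μ₁ μ₂ : ℝ, -2 ≤ μ₁ → μ₁ < μ₂ → μ₂ ≤ -(3:ℝ) / 10 → ∃ U_J : ℝ, 0 < U_J ∧ ∀ U ∈ Set.Ioo (0:ℝ) U_J,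
      ∀ ν ∈ Set.Icc μ₁ μ₂, ∀ ε > 0, ∃ h > 0, ∃ᶠ L : ℕ in atTop,
        ((hubbardTorusWith 2 (L + 1) 1 U (ν + h)).groundStateFunctional totalNumber).re / ((L + 1 : ℕ) : ℝ) ^ 2 -
          ((hubbardTorusWith 2 (L + 1) 1 U (ν - h)).groundStateFunctional totalNumber).re / ((L + 1 : ℕ) : ℝ) ^ 2 ≤ ε) →
    ∃ δ ∈ Set.Ioo (0:ℝ) (1 / 2), ∃ U₀ : ℝ, 0 < U₀ ∧ ∃ C : ℝ, 0 < C ∧ ∀ U ∈ Set.Ioo (0:ℝ) U₀, ∃ μ : ℝ,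
      Tendsto (fun L : ℕ => ((hubbardTorusWith 2 (L + 1) 1 U μ).groundStateFunctional totalNumber).re /
        ((L + 1 : ℕ) : ℝ) ^ 2) atTop (𝓝 (1 - δ)) ∧
      Real.exp (-C / U ^ 2) ≤ dWaveOrderParameter U μ := by
  intro hKpt hM hD
  -- the Kohn–Luttinger level window from (Kpt) (landed p141740) placed inside `[-2, -3/10]` by the certified fillings
  obtain ⟨μ₁, μ₂, γ, U₁, _h4, h12, _h0, hγ, hU₁, hn₁, hn₂, hK⟩ := stub_klLeadingMuWindowOfPoint hKpt
  have hμ₁ : -2 ≤ μ₁ := by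
    by_contra hlt
    have hlt : μ₁ < -2 := not_le.mp hlt
    have := monotone_filling hlt.le
    linarith [filling_neg_two_le_half']
  have hμ₂ : μ₂ ≤ -(3:ℝ) / 10 := by
    by_contra hlt
    have hlt : -(3:ℝ) / 10 < μ₂ := not_le.mp hlt
    have := monotone_filling hlt.le
    linarith [stub_fillingAtNegThreeTenths]
  obtain ⟨U₀, C, hU₀, hC, hMw⟩ := hM μ₁ μ₂ γ U₁ hμ₁ h12 hμ₂ hγ hU₁ hK
  -- the EOS window `[m, μ₂]` and the step `r`
  set m : ℝ := (μ₁ + μ₂) / 2 with hm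
  have hm₁ : μ₁ < m := by rw [hm]; linarith
  have hm₂ : m < μ₂ := by rw [hm]; linarith
  obtain ⟨U_J, hUJ, hJ⟩ := hD m μ₂ (by linarith) hm₂ hμ₂
  set r : ℝ := (μ₂ - m) / 6 with hr
  have hrpos : 0 < r := by rw [hr]; linarith
  set F : ℝ → ℝ := KohnLuttinger.filling (squareDispersion 1 0) with hF
  have hI : ∀ x : ℝ, μ₁ ≤ x → x ≤ μ₂ → x ∈ Set.Icc (-4:ℝ) 4 := fun x h1 h2 =>
    ⟨by linarith, by linarith⟩
  have hF1 : F (m + r) < F (m + 2 * r) :=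
    strictMonoOn_filling (hI _ (by linarith) (by linarith)) (hI _ (by linarith) (by linarith)) (by linarith)
  have hF2 : F (m + 2 * r) < F (μ₂ - 2 * r) :=
    strictMonoOn_filling (hI _ (by linarith) (by linarith)) (hI _ (by linarith) (by linarith)) (by linarith)
  have hF3 : F (μ₂ - 2 * r) < F (μ₂ - r) :=
    strictMonoOn_filling (hI _ (by linarith) (by linarith)) (hI _ (by linarith) (by linarith)) (by linarith)
  have hFlo : F μ₁ ≤ F (m + 2 * r) := monotone_filling (by linarith)
  have hFhi : F (μ₂ - 2 * r) ≤ F μ₂ := monotone_filling (by linarith)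
  -- the doping bracket `a < b` inside `(0, 1/2)`
  set a : ℝ := 1 - F (μ₂ - 2 * r) with ha
  set b : ℝ := 1 - F (m + 2 * r) with hb
  have ha0 : 0 < a := by rw [ha]; linarith
  have hab : a < b := by rw [ha, hb]; linarith
  have hb2 : b < 1 / 2 := by rw [hb]; linarith
  -- the coupling threshold of the brackets
  set U_B : ℝ := r * min (F (m + 2 * r) - F (m + r)) (F (μ₂ - r) - F (μ₂ - 2 * r)) with hUB
  have hUBpos : 0 < U_B := mul_pos hrpos (lt_min (by linarith) (by linarith))
  refine ⟨a, ⟨ha0, hab.trans hb2⟩, min U₀ (min U_J (min U_B (μ₂ - μ₁))),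
    lt_min hU₀ (lt_min hUJ (lt_min hUBpos (by linarith))), C, hC, fun U hU => ?_⟩
  have hUpos : 0 < U := hU.1
  have hUU₀ : U < U₀ := lt_of_lt_of_le hU.2 (min_le_left _ _)
  have hUUJ : U < U_J := lt_of_lt_of_le hU.2 ((min_le_right _ _).trans (min_le_left _ _))
  have hUUB : U < U_B := lt_of_lt_of_le hU.2 ((min_le_right _ _).trans ((min_le_right _ _).trans (min_le_left _ _)))
  have hUw : U < μ₂ - μ₁ := lt_of_lt_of_le hU.2 ((min_le_right _ _).trans ((min_le_right _ _).trans (min_le_right _ _)))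
  -- (D): the limiting equation of state is differentiable on `[m, μ₂]`
  set e : ℝ → ℝ := fun y : ℝ => limUnder atTop (fun L : ℕ =>
    (hubbardTorusWith 2 (L + 1) 1 U y).groundEnergy / ((L + 1 : ℕ) : ℝ) ^ 2) with he
  have hdiff : ∀ ν ∈ Set.Icc m μ₂, DifferentiableAt ℝ e ν := fun ν hν =>
    wcbcs_eos_differentiableAt_of_noDensityJump U ν (hJ U ⟨hUpos, hUUJ⟩ ν hν)
  have hlim : ∀ μ' : ℝ, Tendsto (fun L : ℕ => (hubbardTorusWith 2 (L + 1) 1 U μ').groundEnergy /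
      ((L + 1 : ℕ) : ℝ) ^ 2) atTop (𝓝 (e μ')) := fun μ' => wcbcs_tendsto_gcEnergyDensity_limUnder U μ'
  have hder : ∀ μ' ∈ Set.Icc m μ₂, HasDerivAt e (deriv e μ') μ' := fun μ' hμ' => (hdiff μ' hμ').hasDerivAt
  -- density limits at the two ends, bracketed by the free/interacting sandwich (p148887)
  have hmI : m ∈ Set.Icc m μ₂ := ⟨le_rfl, hm₂.le⟩
  have hμ₂I : μ₂ ∈ Set.Icc m μ₂ := ⟨hm₂.le, le_rfl⟩
  have hTm := wcbcs_tendsto_gcDensity_of_differentiableAt U m (hdiff m hmI)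
  have hTμ₂ := wcbcs_tendsto_gcDensity_of_differentiableAt U μ₂ (hdiff μ₂ hμ₂I)
  obtain ⟨hBm, -⟩ := stub_gcDensitySandwichFree U m r hUpos.le hrpos
  obtain ⟨-, hBμ₂⟩ := stub_gcDensitySandwichFree U μ₂ r hUpos.le hrpos
  rw [hTm.limsup_eq] at hBm
  rw [hTμ₂.liminf_eq] at hBμ₂
  have hUr1 : U / r ≤ F (m + 2 * r) - F (m + r) := by
    rw [div_le_iff₀ hrpos]
    calc U ≤ U_B := hUUB.le
      _ ≤ r * (F (m + 2 * r) - F (m + r)) := by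
          rw [hUB]; exact mul_le_mul_of_nonneg_left (min_le_left _ _) hrpos.le
      _ = (F (m + 2 * r) - F (m + r)) * r := by ring
  have hUr2 : U / r ≤ F (μ₂ - r) - F (μ₂ - 2 * r) := by
    rw [div_le_iff₀ hrpos]
    calc U ≤ U_B := hUUB.le
      _ ≤ r * (F (μ₂ - r) - F (μ₂ - 2 * r)) := by
          rw [hUB]; exact mul_le_mul_of_nonneg_left (min_le_right _ _) hrpos.le
      _ = (F (μ₂ - r) - F (μ₂ - 2 * r)) * r := by ring
  have h₁ : -deriv e m ≤ 1 - b := by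
    have : 1 - b = F (m + 2 * r) := by rw [hb]; ring
    rw [this]; linarith
  have h₂ : 1 - a ≤ -deriv e μ₂ := by
    have : 1 - a = F (μ₂ - 2 * r) := by rw [ha]; ring
    rw [this]; linarith
  -- Darboux–Griffiths: a density-matched `μ(U) ∈ [m, μ₂]` at doping `a`
  obtain ⟨μ, hμ, hdens⟩ := exists_tendsto_gcDensity_of_regularWindow 1 U hm₂.le hlim hder h₁ h₂
    (δ := a) ⟨le_rfl, hab.le⟩
  -- (M): the floor at `μ(U) ∈ [m, μ₂] ⊆ [μ₁ + U/2, μ₂]`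
  have hμ' : μ ∈ Set.Icc (μ₁ + U / 2) μ₂ := ⟨by rw [hm] at hμ; linarith [hμ.1], hμ.2⟩
  exact ⟨μ, hdens, hMw U ⟨hUpos, hUU₀⟩ μ hμ'⟩

end Summit.HubbardSuperconductivity.HubbardSuperconductivity.Theorems
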